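import Mathlib
import Summits.ValiantsHypothesis.ValiantsHypothesis.Theorems.GirthSidonPolySwallowForcesShortRelationHonestTargets
import Summits.ValiantsHypothesis.ValiantsHypothesis.Theorems.GirthSidonPolySwallowForcesShortRelationBornRank

/-!
# Route GirthSidon — crux `PolySwallowForcesShortRelation` (stmt-ValiantsHypothesis-6537), line
`two_ended_honesty`: the TWO-ENDED CANCELLATION BUDGET (polynomial form of census L2 at both places)

For a finite-dimensional `V ⊂ K[x]` with order set `O₀ = ord₀(V ∖ 0)` and degree set `O_∞ = deg(V ∖ 0)`
one has `|O₀| = |O_∞| = dim V =: n` (echelon), and if distinct monomials `x^{D_i}` lie in `span(V·V)` then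

  `#{i : D_i ∉ O₀ + O₀} + |O₀ + O₀| ≤ C(n+1, 2)`   and   `#{i : D_i ∉ O_∞ + O_∞} + |O_∞ + O_∞| ≤ C(n+1, 2)`:

the targets BORN at an end, together with the honest sumset at that end, fit into the order (degree) set
of a space `W ⊇ V·V` of dimension `≤ C(n+1,2)`.  Hence the residual stub `stub_totallyBornTargets` of the
line (all `m` targets totally born, `n ≤ s + 1`) forces `κ(O₀) := C(n+1,2) − |O₀+O₀| ≥ m` AND
`κ(O_∞) ≥ m`: both the order set and the degree set of the source span carry at least `m` additive
coincidences beyond the Sidon count — e.g. a Sidon order set OR a Sidon degree set leaves no totally-born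
target at all (`stub 2'` holds vacuously there).  This is the structural fact L1/L2 of
`Cruxes/MomentCurveElusive/STRATEGY-CENSUS.md` (landed for Laurent series at one place in
`Theorems/GirthSidonMomentCurveElusiveBornBudget.lean`), here for polynomials at both places; it subsumes
the rank count of `…BornRank.lean` when the monomial pool is Sidon.  VP ≠ VNP is not moved. [folklore]
-/

set_option linter.dupNamespace false

namespace Summit.ValiantsHypothesis.ValiantsHypothesis.Theorems

open Polynomial
open scoped Pointwise

namespace PolySwallowBudget

variable {K : Type*} [Field K]

/-- Products of pairs from a finite-dimensional `V ⊂ K[x]` lie in a subspace of dimension at most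
`C(finrank V + 1, 2)` (spanned by the products of unordered pairs of a basis). [folklore] -/
theorem exists_mul_self_le_finrank_le (V : Submodule K K[X]) [Module.Finite K V] :
    ∃ W : Submodule K K[X], Module.Finite K W ∧
      Submodule.span K ((V : Set K[X]) * (V : Set K[X])) ≤ W ∧
      Module.finrank K W ≤ (Module.finrank K V + 1).choose 2 := by
  classical
  set n := Module.finrank K V
  let b := Module.finBasis K V
  let f : Sym2 (Fin n) → K[X] := Sym2.lift ⟨fun j k => (b j : K[X]) * b k, fun j k => mul_comm _ _⟩
  let S : Finset K[X] := (Finset.univ : Finset (Fin n)).sym2.image f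
  refine ⟨Submodule.span K (S : Set K[X]), inferInstance, ?_, ?_⟩
  · rw [Submodule.span_le]
    rintro _ ⟨v, hv, v', hv', rfl⟩
    change v * v' ∈ Submodule.span K (S : Set K[X])
    have hexp : ∀ (w : K[X]) (hw : w ∈ V), w = ∑ j, b.repr ⟨w, hw⟩ j • (b j : K[X]) := by
      intro w hw
      have h := congr_arg (fun x : V => (x : K[X])) (b.sum_repr ⟨w, hw⟩)
      simp only [Submodule.coe_sum, Submodule.coe_smul] at h
      exact h.symm
    rw [hexp v hv, hexp v' hv', Finset.sum_mul]
    refine Submodule.sum_mem _ fun j _ => ?_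
    rw [Finset.mul_sum]
    refine Submodule.sum_mem _ fun k _ => ?_
    rw [Algebra.smul_mul_assoc, Algebra.mul_smul_comm, smul_smul]
    refine Submodule.smul_mem _ _ (Submodule.subset_span ?_)
    simp only [S, Finset.coe_image, Set.mem_image, Finset.mem_coe]
    exact ⟨s(j, k), by simp, rfl⟩
  · calc Module.finrank K (Submodule.span K (S : Set K[X])) ≤ S.card := finrank_span_finset_le_card S
      _ ≤ (Finset.univ : Finset (Fin n)).sym2.card := Finset.card_image_le
      _ = (n + 1).choose 2 := by rw [Finset.card_sym2, Finset.card_univ, Fintype.card_fin]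

/-- `finrank V ≤ |O₀|`: coefficient extraction at the (finitely many) orders is injective on `V`.
[folklore] -/
theorem finrank_le_card_natTrailingDegrees (V : Submodule K K[X]) [Module.Finite K V] :
    Module.finrank K V ≤ (natTrailingDegrees_finite V).toFinset.card := by
  classical
  set O := (natTrailingDegrees_finite V).toFinset
  let L : K[X] →ₗ[K] (O → K) := LinearMap.pi fun e : O => Polynomial.lcoeff K (e : ℕ)
  have hinj : Function.Injective (L.comp V.subtype) := by
    rw [← LinearMap.ker_eq_bot, LinearMap.ker_eq_bot']
    intro v hv
    by_contra hne
    have hv0 : (v : K[X]) ≠ 0 := fun h => hne (Subtype.ext h)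
    have hmem : (v : K[X]).natTrailingDegree ∈ O :=
      (natTrailingDegrees_finite V).mem_toFinset.2 ⟨v, v.2, hv0, rfl⟩
    have h := congrFun hv ⟨_, hmem⟩
    simp only [LinearMap.coe_comp, Function.comp_apply, Submodule.coe_subtype, Pi.zero_apply] at h
    exact Polynomial.trailingCoeff_nonzero_iff_nonzero.mpr hv0 h
  have h := LinearMap.finrank_le_finrank_of_injective hinj
  rwa [Module.finrank_fintype_fun_eq_card, Fintype.card_coe] at h

/-- `finrank V ≤ |O_∞|`: coefficient extraction at the (finitely many) degrees is injective on `V`.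
[folklore] -/
theorem finrank_le_card_natDegrees (V : Submodule K K[X]) [Module.Finite K V] :
    Module.finrank K V ≤ (natDegrees_finite V).toFinset.card := by
  classical
  set O := (natDegrees_finite V).toFinset
  let L : K[X] →ₗ[K] (O → K) := LinearMap.pi fun e : O => Polynomial.lcoeff K (e : ℕ)
  have hinj : Function.Injective (L.comp V.subtype) := by
    rw [← LinearMap.ker_eq_bot, LinearMap.ker_eq_bot']
    intro v hv
    by_contra hne
    have hv0 : (v : K[X]) ≠ 0 := fun h => hne (Subtype.ext h)
    have hmem : (v : K[X]).natDegree ∈ O :=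
      (natDegrees_finite V).mem_toFinset.2 ⟨v, v.2, hv0, rfl⟩
    have h := congrFun hv ⟨_, hmem⟩
    simp only [LinearMap.coe_comp, Function.comp_apply, Submodule.coe_subtype, Pi.zero_apply] at h
    exact Polynomial.leadingCoeff_ne_zero.mpr hv0 h
  have h := LinearMap.finrank_le_finrank_of_injective hinj
  rwa [Module.finrank_fintype_fun_eq_card, Fintype.card_coe] at h

/-- **Echelon equality at `0`**: `|O₀| = finrank V`. [folklore] -/
theorem card_natTrailingDegrees_eq_finrank (V : Submodule K K[X]) [Module.Finite K V] :
    (natTrailingDegrees_finite V).toFinset.card = Module.finrank K V :=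
  le_antisymm (card_le_finrank_of_subset_natTrailingDegrees V _
    (fun _ he => (natTrailingDegrees_finite V).mem_toFinset.1 he)) (finrank_le_card_natTrailingDegrees V)

/-- **Echelon equality at `∞`**: `|O_∞| = finrank V`. [folklore] -/
theorem card_natDegrees_eq_finrank (V : Submodule K K[X]) [Module.Finite K V] :
    (natDegrees_finite V).toFinset.card = Module.finrank K V :=
  le_antisymm (card_le_finrank_of_subset_natDegrees V _
    (fun _ he => (natDegrees_finite V).mem_toFinset.1 he)) (finrank_le_card_natDegrees V)

/-- **Budget at `0`.**  If distinct monomials `x^{D_i}` lie in `span(V·V)`, the indices with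
`D_i ∉ O₀ + O₀` (born at `0`) together with `O₀ + O₀` number at most `C(finrank V + 1, 2)`: both sets
consist of orders of nonzero elements of a space `W ⊇ V·V` of that dimension (`ord(v v') = ord v + ord v'`).
[folklore] -/
theorem card_bornZero_add_card_sumset_le (V : Submodule K K[X]) [Module.Finite K V]
    {m : ℕ} (D : Fin m → ℕ) (hD : Function.Injective D)
    (hmem : ∀ i, ((X : K[X]) ^ D i) ∈ Submodule.span K ((V : Set K[X]) * (V : Set K[X]))) :
    (Finset.univ.filter fun i => D i ∉
        (natTrailingDegrees_finite V).toFinset + (natTrailingDegrees_finite V).toFinset).card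
      + ((natTrailingDegrees_finite V).toFinset + (natTrailingDegrees_finite V).toFinset).card
      ≤ (Module.finrank K V + 1).choose 2 := by
  classical
  set O := (natTrailingDegrees_finite V).toFinset with hOdef
  obtain ⟨W, hWfd, hVW, hW⟩ := exists_mul_self_le_finrank_le V
  haveI := hWfd
  set B := Finset.univ.filter fun i => D i ∉ O + O with hB
  have hZ : ∀ e ∈ B.image D ∪ (O + O), ∃ v ∈ W, v ≠ 0 ∧ v.natTrailingDegree = e := by
    intro e he
    rcases Finset.mem_union.mp he with he | he
    · obtain ⟨i, -, rfl⟩ := Finset.mem_image.mp he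
      refine ⟨_, hVW (hmem i), pow_ne_zero _ Polynomial.X_ne_zero, ?_⟩
      rw [Polynomial.X_pow_eq_monomial, Polynomial.natTrailingDegree_monomial one_ne_zero]
    · rw [Finset.mem_add] at he
      obtain ⟨a, ha, a', ha', rfl⟩ := he
      rw [hOdef, Set.Finite.mem_toFinset] at ha ha'
      obtain ⟨v, hv, hv0, rfl⟩ := ha
      obtain ⟨v', hv', hv0', rfl⟩ := ha'
      exact ⟨v * v', hVW (Submodule.subset_span (Set.mul_mem_mul hv hv')), mul_ne_zero hv0 hv0',
        Polynomial.natTrailingDegree_mul hv0 hv0'⟩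
  have hcard := card_le_finrank_of_subset_natTrailingDegrees W _ hZ
  have hdisj : Disjoint (B.image D) (O + O) := by
    rw [Finset.disjoint_left]
    intro e he he'
    simp only [Finset.mem_image, hB, Finset.mem_filter, Finset.mem_univ, true_and] at he
    obtain ⟨i, hi, rfl⟩ := he
    exact hi he'
  rw [Finset.card_union_of_disjoint hdisj, Finset.card_image_of_injective _ hD] at hcard
  omega

/-- **Budget at `∞`.**  Same as `card_bornZero_add_card_sumset_le` with degrees
(`deg(v v') = deg v + deg v'`). [folklore] -/
theorem card_bornInfty_add_card_sumset_le (V : Submodule K K[X]) [Module.Finite K V]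
    {m : ℕ} (D : Fin m → ℕ) (hD : Function.Injective D)
    (hmem : ∀ i, ((X : K[X]) ^ D i) ∈ Submodule.span K ((V : Set K[X]) * (V : Set K[X]))) :
    (Finset.univ.filter fun i => D i ∉
        (natDegrees_finite V).toFinset + (natDegrees_finite V).toFinset).card
      + ((natDegrees_finite V).toFinset + (natDegrees_finite V).toFinset).card
      ≤ (Module.finrank K V + 1).choose 2 := by
  classical
  set O := (natDegrees_finite V).toFinset with hOdef
  obtain ⟨W, hWfd, hVW, hW⟩ := exists_mul_self_le_finrank_le V
  haveI := hWfd
  set B := Finset.univ.filter fun i => D i ∉ O + O with hB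
  have hZ : ∀ e ∈ B.image D ∪ (O + O), ∃ v ∈ W, v ≠ 0 ∧ v.natDegree = e := by
    intro e he
    rcases Finset.mem_union.mp he with he | he
    · obtain ⟨i, -, rfl⟩ := Finset.mem_image.mp he
      exact ⟨_, hVW (hmem i), pow_ne_zero _ Polynomial.X_ne_zero, by simp⟩
    · rw [Finset.mem_add] at he
      obtain ⟨a, ha, a', ha', rfl⟩ := he
      rw [hOdef, Set.Finite.mem_toFinset] at ha ha'
      obtain ⟨v, hv, hv0, rfl⟩ := ha
      obtain ⟨v', hv', hv0', rfl⟩ := ha'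
      exact ⟨v * v', hVW (Submodule.subset_span (Set.mul_mem_mul hv hv')), mul_ne_zero hv0 hv0',
        Polynomial.natDegree_mul hv0 hv0'⟩
  have hcard := card_le_finrank_of_subset_natDegrees W _ hZ
  have hdisj : Disjoint (B.image D) (O + O) := by
    rw [Finset.disjoint_left]
    intro e he he'
    simp only [Finset.mem_image, hB, Finset.mem_filter, Finset.mem_univ, true_and] at he
    obtain ⟨i, hi, rfl⟩ := he
    exact hi he'
  rw [Finset.card_union_of_disjoint hdisj, Finset.card_image_of_injective _ hD] at hcard
  omega

/-- **Two-ended budget in the setting of the line's stubs.**  For a quadratic polynomial swallowing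
`Γ_i(y) = x^{D_i}` (`D` injective) with `W = span_K(1, y)` of dimension `n ≤ s + 1`: the order set `O₀`
and the degree set `O_∞` of `W ∖ 0` both have exactly `n` elements, and the targets born at `0`
(`D_i ∉ O₀ + O₀`) plus `|O₀ + O₀|`, as well as the targets born at `∞` plus `|O_∞ + O_∞|`, number at
most `C(n+1, 2)`.  In particular totally-born targets cost one additive coincidence at EACH end.
[folklore] -/
theorem twoEnded_budget {s m : ℕ} (y : Fin s → K[X]) (D : Fin m → ℕ) (hD : Function.Injective D)
    (Γ : Fin m → MvPolynomial (Fin s) K) (hΓ : ∀ i, (Γ i).totalDegree ≤ 2)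
    (hy : ∀ i, MvPolynomial.aeval y (Γ i) = Polynomial.X ^ D i) :
    ∃ (n : ℕ) (O₀ Oinf : Finset ℕ), n ≤ s + 1 ∧
      (↑O₀ = {e : ℕ | ∃ v ∈ Submodule.span K (insert (1 : K[X]) (Set.range y)),
        v ≠ 0 ∧ v.natTrailingDegree = e}) ∧
      (↑Oinf = {e : ℕ | ∃ v ∈ Submodule.span K (insert (1 : K[X]) (Set.range y)),
        v ≠ 0 ∧ v.natDegree = e}) ∧
      O₀.card = n ∧ Oinf.card = n ∧
      (Finset.univ.filter fun i : Fin m => D i ∉ O₀ + O₀).card + (O₀ + O₀).card ≤ (n + 1).choose 2 ∧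
      (Finset.univ.filter fun i : Fin m => D i ∉ Oinf + Oinf).card + (Oinf + Oinf).card
        ≤ (n + 1).choose 2 := by
  classical
  set V : Submodule K K[X] := Submodule.span K (insert (1 : K[X]) (Set.range y)) with hVdef
  haveI : Module.Finite K V := Module.Finite.span_of_finite K ((Set.finite_range y).insert 1)
  have hfin : Module.finrank K V ≤ s + 1 := finrank_span_insert_one_range_le y
  have h1 : (1 : K[X]) ∈ V := Submodule.subset_span (Set.mem_insert _ _)
  have hyV : ∀ j, y j ∈ V := fun j => Submodule.subset_span (Set.mem_insert_of_mem _ ⟨j, rfl⟩)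
  have hmem : ∀ i, ((X : K[X]) ^ D i) ∈ Submodule.span K ((V : Set K[X]) * (V : Set K[X])) := by
    intro i
    rw [← hy i]
    exact PolySwallowBornRank.aeval_mem_span_mul_of_totalDegree_le_two y V h1 hyV (Γ i) (hΓ i)
  refine ⟨Module.finrank K V, (natTrailingDegrees_finite V).toFinset, (natDegrees_finite V).toFinset,
    hfin, by simp [hVdef], by simp [hVdef], card_natTrailingDegrees_eq_finrank V,
    card_natDegrees_eq_finrank V, card_bornZero_add_card_sumset_le V D hD hmem,
    card_bornInfty_add_card_sumset_le V D hD hmem⟩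

end PolySwallowBudget

end Summit.ValiantsHypothesis.ValiantsHypothesis.Theorems
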